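import Literature.AlgebraicGeometry.Resolution.AbhyankarToroidalCharts
import Literature.AlgebraicGeometry.Resolution.ValuationRingOpenInNormalizationProofs
import Mathlib.RingTheory.Valuation.LocalSubring
import Mathlib.RingTheory.Polynomial.ScaleRoots
import HarnessLib

/-!
# `K°` is exhausted by the local rings `A_{B,M}` of the toroidal models (Temkin 2013, Cor. 5.4.2) — proved

Topic: `Literature/AlgebraicGeometry/Resolution`. M. Temkin, *Inseparable local uniformization*,
J. Algebra 373 (2013) 65–119 = arXiv:0804.1554v3 (numbers and pages of this version), §5.4,
Cor. 5.4.2 (p. 57): "For a fixed Abhyankar basis `B` the equality `K° = ∪_{M ⊂ Λ°} A_M` holds,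
where `M` runs through all toric monoids in `Λ°`" — one of the four results of §§5.3–5.5 from
which the proof of Thm. 5.5.2 (pp. 60–61) assembles the uniformization of Abhyankar valuations
(`Temkin2013Abhyankar`, `Temkin2013DescentAbhyankar`; vocabulary and the other three results —
Prop. 5.4.3, Thm. 5.5.1 (iii), Thm. 5.5.3 — in `AbhyankarToroidalCharts.lean`). Its role there
(p. 61): "By Corollary 5.4.2 taking a sufficiently large `M` we can also achieve that the local
ring `A_{B,M}` of `x'` contains any finite subset of `K°`" — it makes the toroidal model `X_{B,M}`
refine the prescribed model `X`. This file PROVES it, in exactly that form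
(`exists_isToricMonoid_forall_mem_centreLocalRing`): for finitely many elements of `K°` there is
a toric (even free) monoid `M₀ ⊆ Λ°` such that they all lie in `A_{B,M}` for every `M ⊇ M₀`.

The proof given here is not the printed one (Lemma 5.4.1, via the Riemann–Zariski space `P_K`
and compactness of its constructible topology) but the classical algebraic route through the
finiteness of `K/K_B`, `K_B = k(B)`, all of whose ingredients the tree already PROVES:

* `exists_unit_mul_mem_forall` (`ValuationRingOpenInNormalizationProofs.lean`; Bourbaki,
  *Alg. comm.* VI §8 no. 6 Prop. 6): every `a ∈ K°` is `b/s` with `b`, `s` integral over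
  `K_B° = K° ∩ K_B` and `|s| = 1` (integrality over `K_B°` = lying in every valuation ring over
  it, Mathlib's `iInf_valuationSubring_superset`);
* `exists_toricChart_exponents` — Lemma 5.3.2 with Thm. A.2.1 (`exists_toricChart`,
  `ToricUniformization.lean`), re-proved here with the exponents of the new variables exported:
  the finitely many coefficients of integral equations for the `b`, `s` (elements of
  `K_B ∩ K°`) lie in the local ring at the centre of a chart `k[z, y]`, `zᵢ = x^{eᵢ}` Laurent
  monomials in `B_E` of values `< 1`;
* `isIntegral_mul_of_monic_of_coeff_mul_pow_mem` — clearing the common denominator `q`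
  (`|q| = 1`) of those coefficients makes `qb`, `qs` integral over `k[z, y]`, hence over every
  toric chart `k[M_B]` with `|zᵢ| ∈ M`, so that `a = qb/qs ∈ A_{B,M}`;
* `isToricMonoid_closure_basis` — the free monoid on a `ℤ`-basis of `Λ` inside `Λ°` containing
  the `|zᵢ|` (Thm. A.2.1, `exists_basis_lt_one_subset_closure`, `PerronTransforms.lean`) is a
  toric monoid `M₀` with `M₀^gp = Λ`, and every `M ⊇ M₀` works (`A_{B,M}` grows with `M`).

## Sources

* M. Temkin, *Inseparable local uniformization*, arXiv:0804.1554v3: §5.3, Lemma 5.3.2 (p. 55);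
  §5.4, Cor. 5.4.2 (p. 57); proof of Thm. 5.5.2 (p. 61); Thm. A.2.1 (p. 63).
* N. Bourbaki, *Algèbre commutative*, Ch. VI, §8, no. 6, Prop. 6 (the valuation rings of a
  finite extension over a valuation ring are the localizations of its integral closure), as
  proved in `ValuationRingOpenInNormalizationProofs.lean`.
-/

noncomputable section

namespace Literature.AlgebraicGeometry.Resolution

open MvPolynomial IsLocalRing ValuationSubring

universe u

/-! ### Toric charts with explicit exponents (variant of `exists_toricChart`) -/

section ToricChart

variable {k K : Type u} [Field k] [Field K] [Algebra k K]
variable (O : ValuationSubring K) [Algebra k O] [IsScalarTower k O K]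
variable {ι κ : Type*} [Fintype κ] (y : ι → O) (x : κ → K)

/-- **Toric charts, with the new variables exported as Laurent monomials** — the theorem
`exists_toricChart` of `ToricUniformization.lean` (Temkin 2013, §5.1 and Lemma 5.3.2 with
Thm. A.2.1: finitely many fractions `a_l/b_l ∈ K°` of polynomials in an Abhyankar system
`B = x ⊔ y` lie in the local ring at the centre of a chart `k[z, y]`, `z` of values `< 1`,
`(z, y)` algebraically independent), with ONE extra datum in the conclusion: the exponent
vectors `eᵢ ∈ ℤ^κ` with `zᵢ = x^{eᵢ}` (they are there a `ℤ`-basis of the exponent lattice, found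
by Perron transforms; the original statement records only that the `xⱼ` are Laurent monomials
in the `zᵢ`). The proof is that of `exists_toricChart`, verbatim but for the export; the
export is what places the chart `k[z, y]` inside the toric charts `k[M_B]` of
`AbhyankarToroidalCharts.lean` (`zᵢ` is the monomial `x^{eᵢ}`, of value in `M` as soon as
`|zᵢ| ∈ M`). [cite: Temkin2013, Section 5.1 (p. 51) and Lemma 5.3.2 (p. 55 of arXiv:0804.1554v3)] -/
theorem exists_toricChart_exponents (hy : AlgebraicIndependent k fun i => residue O (y i))
    (hx0 : ∀ j, x j ≠ 0)
    (hx : LinearIndependent ℤ fun j =>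
      Additive.ofMul (Units.mk0 (O.valuation (x j)) (valuation_ne_zero_of_ne_zero O (hx0 j))))
    {σ : Type*} [Fintype σ]
    (a b : σ → MvPolynomial κ (Algebra.adjoin k (Set.range fun i => (y i : K))))
    (hb : ∀ l, b l ≠ 0) (hab : ∀ l, O.valuation (aeval x (a l)) ≤ O.valuation (aeval x (b l))) :
    ∃ (N : ℕ) (ex : Fin N → (κ →₀ ℤ)) (z : Fin N → K),
      (∀ i, z i = (ex i).prod fun j (n : ℤ) => x j ^ n) ∧
      (∀ i, z i ≠ 0) ∧ (∀ i, O.valuation (z i) < 1) ∧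
      AlgebraicIndependent k (Sum.elim z fun i => (y i : K)) ∧
      (∀ j, ∃ r : Fin N → ℤ, x j = ∏ i, z i ^ r i) ∧
      ∀ l, ∃ p q : K, p ∈ Algebra.adjoin k (Set.range (Sum.elim z fun i => (y i : K))) ∧
        q ∈ Algebra.adjoin k (Set.range (Sum.elim z fun i => (y i : K))) ∧
        O.valuation q = 1 ∧ aeval x (a l) / aeval x (b l) = p / q := by
  classical
  -- Step 0: values of Laurent monomials, as a homomorphism `φ : ℤ^κ → Γˣ`
  let v : (κ →₀ ℤ) → (ValuationSubring.ValueGroup O)ˣ := fun d =>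
    Units.mk0 (O.valuation (d.prod fun j (n : ℤ) => x j ^ n))
      (valuation_ne_zero_of_ne_zero O (lmonomial_ne_zero x hx0 d))
  have hv : ∀ d, ((v d : (ValuationSubring.ValueGroup O)ˣ) : ValuationSubring.ValueGroup O) =
      O.valuation (d.prod fun j (n : ℤ) => x j ^ n) := fun d => rfl
  have hv_add : ∀ d d', v (d + d') = v d * v d' := fun d d' =>
    Units.ext (by rw [Units.val_mul, hv, hv, hv, lmonomial_add x hx0, map_mul])
  let φ : (κ →₀ ℤ) →+ Additive (ValuationSubring.ValueGroup O)ˣ :=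
    { toFun := fun d => Additive.ofMul (v d)
      map_zero' := by
        change Additive.ofMul (v 0) = 0
        rw [ofMul_eq_zero]
        exact Units.ext (by rw [hv, Finsupp.prod_zero_index, map_one, Units.val_one])
      map_add' := fun d d' => by
        change Additive.ofMul (v (d + d')) = Additive.ofMul (v d) + Additive.ofMul (v d')
        rw [hv_add, ofMul_mul] }
  have hφ : ∀ d, φ d = Additive.ofMul (v d) := fun d => rfl
  have hφsingle : ∀ j (n : ℤ), φ (Finsupp.single j n) =
      n • Additive.ofMul (Units.mk0 (O.valuation (x j))
        (valuation_ne_zero_of_ne_zero O (hx0 j))) := by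
    intro j n
    rw [hφ, ← ofMul_zpow]
    congr 1
    ext
    rw [hv, lmonomial_single, map_zpow₀, Units.val_zpow_eq_zpow_val, Units.val_mk0]
  have hφlc : φ = (Finsupp.linearCombination ℤ (fun j => Additive.ofMul
      (Units.mk0 (O.valuation (x j)) (valuation_ne_zero_of_ne_zero O (hx0 j))))).toAddMonoidHom := by
    refine Finsupp.addHom_ext fun j n => ?_
    rw [hφsingle, LinearMap.toAddMonoidHom_coe, Finsupp.linearCombination_single]
  have hφinj : Function.Injective φ := by
    rw [hφlc]
    exact fun d d' h => hx.finsuppLinearCombination_injective h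
  -- Step 1: dominant exponents of the denominators and the finite set of exponents
  choose μb hμb hμbmax hμbval using fun l => exists_dominant_monomial O y x hy hx0 hx (b l) (hb l)
  let ιZ : (κ →₀ ℕ) → (κ →₀ ℤ) := fun μ => μ.mapRange (fun n : ℕ => (n : ℤ)) (by simp)
  have hιZ : ∀ μ, (ιZ μ).prod (fun j (n : ℤ) => x j ^ n) = μ.prod fun j (n : ℕ) => x j ^ n :=
    fun μ => lmonomial_natCast x μ
  let D : Finset (κ →₀ ℤ) := Finset.univ.biUnion fun l =>
    ((a l).support ∪ (b l).support).image fun μ => ιZ μ - ιZ (μb l)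
  have hmemD : ∀ l, ∀ μ ∈ (a l).support ∪ (b l).support, ιZ μ - ιZ (μb l) ∈ D :=
    fun l μ hμ => Finset.mem_biUnion.mpr ⟨l, Finset.mem_univ l, Finset.mem_image.mpr ⟨μ, hμ, rfl⟩⟩
  have hbound : ∀ l, ∀ μ ∈ (a l).support ∪ (b l).support,
      O.valuation (μ.prod fun j (n : ℕ) => x j ^ n) ≤
        O.valuation ((μb l).prod fun j (n : ℕ) => x j ^ n) := by
    intro l μ hμ
    rcases Finset.mem_union.mp hμ with hμ | hμ
    · have ha0 : a l ≠ 0 := by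
        rintro h
        rw [h, support_zero] at hμ
        simp at hμ
      obtain ⟨μa, -, hμamax, hμaval⟩ := exists_dominant_monomial O y x hy hx0 hx (a l) ha0
      calc O.valuation (μ.prod fun j (n : ℕ) => x j ^ n)
          ≤ O.valuation (μa.prod fun j (n : ℕ) => x j ^ n) := hμamax μ hμ
        _ = O.valuation (aeval x (a l)) := hμaval.symm
        _ ≤ O.valuation (aeval x (b l)) := hab l
        _ = O.valuation ((μb l).prod fun j (n : ℕ) => x j ^ n) := hμbval l
    · exact hμbmax l μ hμ
  have hD : ∀ d ∈ D, Additive.toMul (φ d) ≤ 1 := by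
    intro d hd
    obtain ⟨l, -, hd⟩ := Finset.mem_biUnion.mp hd
    obtain ⟨μ, hμ, rfl⟩ := Finset.mem_image.mp hd
    rw [map_sub, toMul_sub, div_le_one', hφ, hφ, toMul_ofMul, toMul_ofMul, ← Units.val_le_val,
      hv, hv, hιZ, hιZ]
    exact hbound l μ hμ
  -- Step 2: a positive basis of the exponent lattice (Perron transforms, Thm. A.2.1)
  haveI : AddGroup.FG (κ →₀ ℤ) := Module.Finite.iff_addGroup_fg.mp inferInstance
  obtain ⟨e, he1, -, hecoef⟩ := exists_basis_lt_one_of_injective φ hφinj D hD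
  -- the new variables
  let z : Fin (Module.finrank ℤ (κ →₀ ℤ)) → K := fun i => (e i).prod fun j (n : ℤ) => x j ^ n
  have hz : ∀ i, z i = (e i).prod fun j (n : ℤ) => x j ^ n := fun i => rfl
  have hz0 : ∀ i, z i ≠ 0 := fun i => lmonomial_ne_zero x hx0 _
  have hz1 : ∀ i, O.valuation (z i) < 1 := fun i => by
    have := he1 i
    rw [hφ, toMul_ofMul, ← Units.val_lt_val, Units.val_one, hv] at this
    exact this
  -- Step 3: `(z, y)` is an Abhyankar system, hence algebraically independent
  have hzli : LinearIndependent ℤ fun i => Additive.ofMul (Units.mk0 (O.valuation (z i))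
      (valuation_ne_zero_of_ne_zero O (hz0 i))) := by
    have heq : (fun i => Additive.ofMul (Units.mk0 (O.valuation (z i))
        (valuation_ne_zero_of_ne_zero O (hz0 i)))) = φ.toIntLinearMap ∘ e := by
      funext i
      rfl
    rw [heq]
    exact e.linearIndependent.map' _ (LinearMap.ker_eq_bot.mpr hφinj)
  have hB : AlgebraicIndependent k (Sum.elim z fun i => (y i : K)) :=
    algebraicIndependent_sumElim_of_valuation O y hy z
      (injective_valuation_prod_pow O z hz0 hzli)
  -- Step 4: the `xⱼ` are Laurent monomials in the `zᵢ`
  have hxz : ∀ j, ∃ r : Fin (Module.finrank ℤ (κ →₀ ℤ)) → ℤ, x j = ∏ i, z i ^ r i := by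
    intro j
    refine ⟨fun i => e.repr (Finsupp.single j 1) i, ?_⟩
    calc x j = (Finsupp.single j (1 : ℤ)).prod (fun j (n : ℤ) => x j ^ n) := by
            rw [lmonomial_single, zpow_one]
      _ = (∑ i, e.repr (Finsupp.single j 1) i • e i).prod (fun j (n : ℤ) => x j ^ n) := by
            rw [e.sum_repr]
      _ = ∏ i, z i ^ (e.repr (Finsupp.single j 1) i) := by
            rw [lmonomial_sum x hx0]
            exact Finset.prod_congr rfl fun i _ => lmonomial_zsmul x hx0 _ _
  -- Step 5: the fractions lie in the local ring of `k[z, y]` at the centre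
  have hRF_le : ∀ c : Algebra.adjoin k (Set.range fun i => (y i : K)),
      (c : K) ∈ Algebra.adjoin k (Set.range (Sum.elim z fun i => (y i : K))) := fun c =>
    Algebra.adjoin_mono (by rintro _ ⟨i, rfl⟩; exact ⟨Sum.inr i, rfl⟩) c.2
  have hzR : ∀ i, z i ∈ Algebra.adjoin k (Set.range (Sum.elim z fun i => (y i : K))) :=
    fun i => Algebra.subset_adjoin ⟨Sum.inl i, rfl⟩
  have hmemR : ∀ l (Q : MvPolynomial κ (Algebra.adjoin k (Set.range fun i => (y i : K)))),
      (∀ μ ∈ Q.support, ιZ μ - ιZ (μb l) ∈ D) →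
      aeval x Q * ((ιZ (μb l)).prod fun j (n : ℤ) => x j ^ n)⁻¹ ∈
        Algebra.adjoin k (Set.range (Sum.elim z fun i => (y i : K))) := by
    intro l Q hQ
    rw [MvPolynomial.aeval_def, MvPolynomial.eval₂_eq, Finset.sum_mul]
    refine Subalgebra.sum_mem _ fun μ hμ => ?_
    obtain ⟨c, hc⟩ := hecoef _ (hQ μ hμ)
    have hmon : (∏ i ∈ μ.support, x i ^ μ i) * ((ιZ (μb l)).prod fun j (n : ℤ) => x j ^ n)⁻¹ =
        ∏ i, z i ^ c i := by
      rw [show (∏ i ∈ μ.support, x i ^ μ i) = μ.prod (fun j (n : ℕ) => x j ^ n) from rfl, ← hιZ,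
        ← lmonomial_sub x hx0, hc, lmonomial_sum x hx0]
      exact Finset.prod_congr rfl fun i _ => lmonomial_nsmul x hx0 _ _
    rw [mul_assoc, hmon]
    exact Subalgebra.mul_mem _ (hRF_le _)
      (Subalgebra.prod_mem _ fun i _ => Subalgebra.pow_mem _ (hzR i) _)
  have hfrac : ∀ l, ∃ p q : K, p ∈ Algebra.adjoin k (Set.range (Sum.elim z fun i => (y i : K))) ∧
      q ∈ Algebra.adjoin k (Set.range (Sum.elim z fun i => (y i : K))) ∧
      O.valuation q = 1 ∧ aeval x (a l) / aeval x (b l) = p / q := by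
    intro l
    have hm0 : ((ιZ (μb l)).prod fun j (n : ℤ) => x j ^ n) ≠ 0 := lmonomial_ne_zero x hx0 _
    refine ⟨aeval x (a l) * ((ιZ (μb l)).prod fun j (n : ℤ) => x j ^ n)⁻¹,
      aeval x (b l) * ((ιZ (μb l)).prod fun j (n : ℤ) => x j ^ n)⁻¹,
      hmemR l (a l) (fun μ hμ => hmemD l μ (Finset.mem_union_left _ hμ)),
      hmemR l (b l) (fun μ hμ => hmemD l μ (Finset.mem_union_right _ hμ)), ?_, ?_⟩
    · rw [map_mul, map_inv₀, hμbval l, hιZ]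
      exact mul_inv_cancel₀ (by rw [← hιZ]; exact valuation_ne_zero_of_ne_zero O hm0)
    · exact (mul_div_mul_right _ _ (inv_ne_zero hm0)).symm
  exact ⟨_, fun i => e i, z, hz, hz0, hz1, hB, hxz, hfrac⟩


end ToricChart

/-! ### Integrality after clearing denominators of value one -/

section Integral

variable {k K : Type u} [Field k] [Field K] [Algebra k K]

/-- **Clearing denominators in an integral equation**: if `w` is a root of a monic polynomial
`p` over a ring `S → K` and `Q ∈ K` is such that `cᵢ Q^{n-i} ∈ R` for all lower coefficients
`cᵢ` of `p` (`n = deg p`) — e.g. `Q` a common denominator of the `cᵢ` — then `Q w` is integral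
over the subalgebra `R` (it is a root of `Xⁿ + Σ cᵢ Q^{n-i} Xⁱ`). [folklore] -/
theorem isIntegral_mul_of_monic_of_coeff_mul_pow_mem {S : Type*} [CommRing S] [Algebra S K]
    (R : Subalgebra k K) {w Q : K} {p : Polynomial S} (hp : p.Monic)
    (hpw : p.eval₂ (algebraMap S K) w = 0)
    (hcoef : ∀ i < p.natDegree, algebraMap S K (p.coeff i) * Q ^ (p.natDegree - i) ∈ R) :
    IsIntegral R (Q * w) := by
  classical
  set n := p.natDegree with hn
  let f : Fin n → R := fun i => ⟨algebraMap S K (p.coeff i) * Q ^ (n - i), hcoef i i.2⟩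
  let P : Polynomial R :=
    Polynomial.X ^ n + ∑ i : Fin n, Polynomial.C (f i) * Polynomial.X ^ (i : ℕ)
  have hPmonic : P.Monic := Polynomial.monic_X_pow_add (Polynomial.degree_sum_fin_lt f)
  refine ⟨P, hPmonic, ?_⟩
  have h1 : p.eval₂ (algebraMap S K) w =
      w ^ n + ∑ i : Fin n, algebraMap S K (p.coeff i) * w ^ (i : ℕ) := by
    rw [← Polynomial.aeval_def, Polynomial.aeval_eq_sum_range, Finset.sum_range_succ, ← hn,
      hp.coeff_natDegree, one_smul, add_comm, Finset.sum_range (fun i => p.coeff i • w ^ i)]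
    simp only [Algebra.smul_def]
  have h2 : P.eval₂ (algebraMap R K) (Q * w) = Q ^ n * p.eval₂ (algebraMap S K) w := by
    simp only [P, Polynomial.eval₂_add, Polynomial.eval₂_pow, Polynomial.eval₂_X,
      Polynomial.eval₂_finsetSum, Polynomial.eval₂_mul, Polynomial.eval₂_C]
    rw [h1, mul_add, Finset.mul_sum, mul_pow]
    congr 1
    refine Finset.sum_congr rfl fun i _ => ?_
    have hi : (i : ℕ) ≤ n := i.2.le
    show (algebraMap S K (p.coeff i) * Q ^ (n - i)) * (Q * w) ^ (i : ℕ) =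
      Q ^ n * (algebraMap S K (p.coeff ↑i) * w ^ (i : ℕ))
    rw [mul_pow, show Q ^ n = Q ^ (n - i) * Q ^ (i : ℕ) by rw [← pow_add, Nat.sub_add_cancel hi]]
    ring
  rw [h2, hpw, mul_zero]

end Integral

/-! ### Basis monoids are toric -/

section Monoid

variable {K : Type u} [Field K] (O : ValuationSubring K)

/-- Membership in the monoid generated by a `ℤ`-basis of the value group, through coordinates
(`mem_closure_range_basis_iff` of `PerronTransforms.lean`, multiplicative form). [folklore] -/
theorem mem_submonoidClosure_basis_iff {Λ : Type*} [CommGroup Λ] {n : ℕ}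
    (b : Module.Basis (Fin n) ℤ (Additive Λ)) (m : Λ) :
    m ∈ Submonoid.closure (Set.range fun i => Additive.toMul (b i)) ↔
      ∀ i, 0 ≤ b.repr (Additive.ofMul m) i := by
  rw [← mem_closure_range_basis_iff]
  have h := Submonoid.toAddSubmonoid_closure (Set.range fun i => Additive.toMul (b i))
  have hpre : Additive.toMul ⁻¹' (Set.range fun i => Additive.toMul (b i)) = Set.range b := by
    ext v
    simp only [Set.mem_preimage, Set.mem_range]
    exact ⟨fun ⟨i, hi⟩ => ⟨i, Additive.toMul.injective hi⟩, fun ⟨i, hi⟩ => ⟨i, by rw [hi]⟩⟩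
  rw [hpre] at h
  rw [← h]
  rfl

/-- **The free monoid generated by a `ℤ`-basis of `Λ = |K^×|` is a toric monoid with `M^gp = Λ`**
(Temkin 2013, §5.3, p. 55: free submonoids "are cofinal in the family of toric submonoids";
App. A.1). PROVED: finitely generated, saturated in `Λ` (coordinates), generating `Λ`
(`subgroup_closure_range_basis`). [cite: Temkin2013, Section 5.3 (p. 55)] -/
theorem isToricMonoid_closure_basis {n : ℕ}
    (b : Module.Basis (Fin n) ℤ (Additive (ValueGroup O)ˣ)) :
    IsToricMonoid O (Submonoid.closure (Set.range fun i => Additive.toMul (b i))) := by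
  classical
  refine ⟨⟨Finset.univ.image fun i => Additive.toMul (b i), by simp⟩, ?_, ?_⟩
  · intro γ m hm hγ
    rw [mem_submonoidClosure_basis_iff] at hγ ⊢
    intro i
    have h := hγ i
    rw [ofMul_pow, map_nsmul, Finsupp.smul_apply, nsmul_eq_mul] at h
    exact (mul_nonneg_iff_of_pos_left (by exact_mod_cast hm)).mp h
  · refine top_le_iff.mp ?_
    rw [← subgroup_closure_range_basis b]
    exact Subgroup.closure_mono Submonoid.subset_closure

end Monoid

/-! ### Cor. 5.4.2: `K° = ⋃_M A_{B,M}` -/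

section Exhaustion

variable {k K : Type u} [Field k] [Field K] [Algebra k K]

/-- **Temkin 2013, Cor. 5.4.2** (p. 57: "For a fixed Abhyankar basis `B` the equality
`K° = ∪_{M ⊂ Λ°} A_M` holds, where `M` runs through all toric monoids in `Λ°`"), PROVED in the
"sufficiently large `M`, finite subset" form in which the proof of Thm. 5.5.2 uses it (p. 61: "By
Corollary 5.4.2 taking a sufficiently large `M` we can also achieve that the local ring `A_{B,M}`
of `x'` contains any finite subset of `K°`"): for a finitely generated Abhyankar valued field
`K` over the trivially valued `k ⊆ K°`, an Abhyankar transcendence basis `B = x ⊔ y` and a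
finite `Z ⊆ K°` there is a toric monoid `M₀ ⊆ Λ°` (even a free one, generated by a `ℤ`-basis of
`Λ`) such that `Z ⊆ A_{B,M}` for every monoid `M ⊇ M₀` (`centreLocalRing O (nrAlg (toricChart
O x y M))`, `AbhyankarToroidalCharts.lean`). The proof here is NOT the printed one (Lemma
5.4.1: discreteness of the fibre of the Riemann–Zariski space `P_K → P_{k(B)}` and compactness
of the constructible topology), but the classical algebraic one: `K/K_B` being finite
(`K_B = k(B)`), every `a ∈ K°` is `b/s` with `b`, `s` integral over `K_B° = K° ∩ K_B` and
`|s| = 1` (Bourbaki, *Alg. comm.* VI §8 no. 6 Prop. 6 — the valuation rings over `K_B°` are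
the localizations of its integral closure —, PROVED in the tree as `exists_unit_mul_mem_forall`,
`ValuationRingOpenInNormalizationProofs.lean`); the finitely many coefficients of integral
equations for the `b`, `s` lie in `K_B ∩ K°`, hence (Lemma 5.3.2 with Thm. A.2.1:
`exists_toricChart_exponents`) in the local ring of a chart `k[z, y] ⊆ k[M_B]`, `zᵢ = x^{eᵢ}`
Laurent monomials of values `< 1`; clearing their common denominator `q`, `|q| = 1`, makes
`qb`, `qs` integral over `k[M_B]` (`isIntegral_mul_of_monic_of_coeff_mul_pow_mem`), so that
`a = qb/qs ∈ A_{B,M}` as soon as `M` contains the values `|zᵢ|`, e.g. for `M ⊇ M₀` the free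
monoid on a basis of `Λ` inside `Λ°` containing them (Thm. A.2.1,
`exists_basis_lt_one_subset_closure`). [cite: Temkin2013, Cor. 5.4.2 (p. 57 of arXiv:0804.1554v3)] -/
theorem exists_isToricMonoid_forall_mem_centreLocalRing (hfg : (⊤ : IntermediateField k K).FG)
    (O : ValuationSubring K) (hk : ∀ c : k, algebraMap k K c ∈ O)
    (hD : transcendenceDefect k O hk = 0) {E F : ℕ} (x : Fin E → K) (y : Fin F → O)
    (hB : IsAbhyankarBasis O hk x y) (Z : Finset K) (hZ : ∀ z ∈ Z, z ∈ O) :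
    ∃ M₀ : Submonoid (ValueGroup O)ˣ, IsToricMonoid O M₀ ∧ M₀ ≤ valuationMonoid O ∧
      (∃ (n : ℕ) (b : Module.Basis (Fin n) ℤ (Additive (ValueGroup O)ˣ)),
        M₀ = Submonoid.closure (Set.range fun i => Additive.toMul (b i))) ∧
      ∀ M : Submonoid (ValueGroup O)ˣ, M₀ ≤ M →
        ∀ z ∈ Z, z ∈ centreLocalRing O (nrAlg (toricChart (k := k) O x y M)) := by
  classical
  letI := algebraOfMem k O hk
  haveI := isScalarTower_algebraOfMem k O hk
  -- the field `K_B = k(B)`; `K/K_B` is algebraic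
  set FB : IntermediateField k K :=
    IntermediateField.adjoin k (Set.range (Sum.elim x fun i => (y i : K))) with hFB
  haveI : Algebra.IsAlgebraic FB K := hB.isTranscendenceBasis.isAlgebraic_field
  -- `K_B° = K° ∩ K_B` and its image `s ⊆ K`
  set O' : ValuationSubring FB := O.comap (algebraMap FB K) with hO'
  set s : Set K := {c | c ∈ FB ∧ c ∈ O} with hs
  have hsU : ∀ U : ValuationSubring K, s ⊆ U → O' ≤ U.comap (algebraMap FB K) :=
    fun U hU c hc => hU ⟨c.2, hc⟩
  have hs_le : Subring.closure s ≤ FB.toSubring ⊓ O.toSubring :=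
    Subring.closure_le.mpr fun c hc => ⟨hc.1, hc.2⟩
  -- Bourbaki: every `z ∈ Z` is `b/s` with `b`, `s` integral over `K_B°`, `|s| = 1`
  have key : ∀ z ∈ Z, ∃ yz : K, O.valuation yz = 1 ∧
      (∃ pd : Polynomial (Subring.closure s), pd.Monic ∧
        pd.eval₂ (algebraMap (Subring.closure s) K) yz = 0) ∧
      (∃ pn : Polynomial (Subring.closure s), pn.Monic ∧
        pn.eval₂ (algebraMap (Subring.closure s) K) (z * yz) = 0) := by
    intro z hz
    obtain ⟨yz, hyz1, hyU⟩ :=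
      exists_unit_mul_mem_forall (k := FB) (l := K) (O' := O') (W := O) rfl (hZ z hz)
    have hmem : ∀ w : K, (∀ U : ValuationSubring K, s ⊆ U → w ∈ U) →
        IsIntegral (Subring.closure s) w := by
      intro w hw
      have h1 : w ∈ ⨅ V : {V : ValuationSubring K // s ⊆ V.toSubring}, V.1.toSubring :=
        Subring.mem_iInf.mpr fun V => hw V.1 V.2
      rw [iInf_valuationSubring_superset] at h1
      exact h1
    exact ⟨yz, hyz1, hmem yz (fun U hU => (hyU U (hsU U hU)).1),
      hmem (z * yz) (fun U hU => (hyU U (hsU U hU)).2)⟩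
  choose! yz hyz1 hpd hpn using key
  choose! pd hpdm hpde using hpd
  choose! pn hpnm hpne using hpn
  -- the finitely many coefficients of these integral equations, all in `K_B ∩ K°`
  set T : Finset K := Z.biUnion fun z =>
    ((Finset.range ((pd z).natDegree + 1)).image fun i => ((pd z).coeff i : K)) ∪
      ((Finset.range ((pn z).natDegree + 1)).image fun i => ((pn z).coeff i : K)) with hT
  have hTd : ∀ z ∈ Z, ∀ i < (pd z).natDegree, ((pd z).coeff i : K) ∈ T := fun z hz i hi =>
    Finset.mem_biUnion.mpr ⟨z, hz, Finset.mem_union_left _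
      (Finset.mem_image.mpr ⟨i, Finset.mem_range.mpr (Nat.lt_succ_of_lt hi), rfl⟩)⟩
  have hTn : ∀ z ∈ Z, ∀ i < (pn z).natDegree, ((pn z).coeff i : K) ∈ T := fun z hz i hi =>
    Finset.mem_biUnion.mpr ⟨z, hz, Finset.mem_union_right _
      (Finset.mem_image.mpr ⟨i, Finset.mem_range.mpr (Nat.lt_succ_of_lt hi), rfl⟩)⟩
  have hTs : ∀ t ∈ T, t ∈ FB ∧ t ∈ O := by
    intro t ht
    obtain ⟨z, -, ht⟩ := Finset.mem_biUnion.mp ht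
    rcases Finset.mem_union.mp ht with ht | ht
    · obtain ⟨i, -, rfl⟩ := Finset.mem_image.mp ht
      exact hs_le ((pd z).coeff i).2
    · obtain ⟨i, -, rfl⟩ := Finset.mem_image.mp ht
      exact hs_le ((pn z).coeff i).2
  -- a toric chart `k[z', y]`, `z'ᵢ = x^{eᵢ}`, whose local ring at the centre contains `T`
  have hadj : IntermediateField.adjoin k ((Set.range fun i => (y i : K)) ∪ Set.range x) = FB := by
    rw [hFB, Set.Sum.elim_range, Set.union_comm]
  have hsK : ∀ l : ↥T, (l : K) ∈
      IntermediateField.adjoin k ((Set.range fun i => (y i : K)) ∪ Set.range x) := fun l => by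
    rw [hadj]
    exact (hTs l l.2).1
  have hsO : ∀ l : ↥T, (l : K) ∈ O := fun l => (hTs l l.2).2
  choose Qa Qb hQb hab hsrep using fun l : ↥T => exists_aeval_div_aeval_eq O y x (l : K) (hsK l) (hsO l)
  obtain ⟨N, ex, z', hz'def, hz'0, hz'1, -, -, hfrac⟩ := exists_toricChart_exponents O y x
    hB.algebraicIndependent_residue hB.ne_zero hB.linearIndependent Qa Qb hQb hab
  set R : Subalgebra k K := Algebra.adjoin k (Set.range (Sum.elim z' fun i => (y i : K))) with hR
  choose p q hp hq hq1 hpq using hfrac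
  have ht_eq : ∀ l : ↥T, (l : K) = p l / q l := fun l => (hsrep l).trans (hpq l)
  have hq0 : ∀ l, q l ≠ 0 := fun l h => by
    have := hq1 l
    rw [h, map_zero] at this
    exact zero_ne_one this
  -- the common denominator `Qd = ∏ q_l`, of value `1`
  set Qd : K := ∏ l : ↥T, q l with hQd
  have hQdR : Qd ∈ R := Subalgebra.prod_mem _ fun l _ => hq l
  have hQd1 : O.valuation Qd = 1 := by
    rw [hQd, map_prod]
    exact Finset.prod_eq_one fun l _ => hq1 l
  have hQd0 : Qd ≠ 0 := fun h => by
    rw [h, map_zero] at hQd1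
    exact zero_ne_one hQd1
  -- `t * Qd ^ m ∈ R` for `t ∈ T` and `m ≥ 1`
  have hcoefR : ∀ t ∈ T, ∀ m : ℕ, 0 < m → t * Qd ^ m ∈ R := by
    intro t ht m hm
    obtain ⟨m', rfl⟩ : ∃ m', m = m' + 1 := Nat.exists_eq_succ_of_ne_zero hm.ne'
    have hsplit : Qd = q ⟨t, ht⟩ * ∏ l ∈ Finset.univ.erase ⟨t, ht⟩, q l :=
      (Finset.mul_prod_erase _ _ (Finset.mem_univ _)).symm
    have hrest : (∏ l ∈ Finset.univ.erase (⟨t, ht⟩ : ↥T), q l) ∈ R :=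
      Subalgebra.prod_mem _ fun l _ => hq l
    have heq : t * Qd ^ (m' + 1) =
        p ⟨t, ht⟩ * (∏ l ∈ Finset.univ.erase ⟨t, ht⟩, q l) * Qd ^ m' := by
      set l₀ : ↥T := ⟨t, ht⟩ with hl₀
      have ht' : t = p l₀ / q l₀ := ht_eq l₀
      have h1 : t * q l₀ = p l₀ := by
        rw [ht', div_mul_cancel₀ _ (hq0 l₀)]
      calc t * Qd ^ (m' + 1) = t * Qd * Qd ^ m' := by ring
        _ = t * (q l₀ * ∏ l ∈ Finset.univ.erase l₀, q l) * Qd ^ m' := by rw [← hsplit]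
        _ = (t * q l₀) * (∏ l ∈ Finset.univ.erase l₀, q l) * Qd ^ m' := by ring
        _ = p l₀ * (∏ l ∈ Finset.univ.erase l₀, q l) * Qd ^ m' := by rw [h1]
    rw [heq]
    exact Subalgebra.mul_mem _ (Subalgebra.mul_mem _ (hp _) hrest) (Subalgebra.pow_mem _ hQdR _)
  -- hence `Qd * yz` and `Qd * (z * yz)` are integral over `R`
  have hintR : ∀ z ∈ Z, IsIntegral R (Qd * yz z) ∧ IsIntegral R (Qd * (z * yz z)) := by
    intro z hz
    refine ⟨isIntegral_mul_of_monic_of_coeff_mul_pow_mem R (hpdm z hz) (hpde z hz) ?_,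
      isIntegral_mul_of_monic_of_coeff_mul_pow_mem R (hpnm z hz) (hpne z hz) ?_⟩
    · intro i hi
      exact hcoefR _ (hTd z hz i hi) _ (Nat.sub_pos_of_lt hi)
    · intro i hi
      exact hcoefR _ (hTn z hz i hi) _ (Nat.sub_pos_of_lt hi)
  -- the threshold: a free monoid `M₀ ⊆ Λ°` on a basis of `Λ` containing the values `|z'ᵢ|`
  let γ : Fin N → (ValueGroup O)ˣ := fun i =>
    Units.mk0 (O.valuation (z' i)) (valuation_ne_zero_of_ne_zero O (hz'0 i))
  have hγle : ∀ m ∈ (Finset.univ.image γ), m ≤ 1 := by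
    intro m hm
    obtain ⟨i, -, rfl⟩ := Finset.mem_image.mp hm
    rw [← Units.val_le_val]
    exact (hz'1 i).le
  haveI : Group.FG (ValueGroup O)ˣ := valueGroup_fg_of_transcendenceDefect_eq_zero O hfg hk hD
  obtain ⟨n, b, -, hγsub, hle1⟩ := exists_basis_lt_one_subset_closure (Finset.univ.image γ) hγle
  refine ⟨Submonoid.closure (Set.range fun i => Additive.toMul (b i)), isToricMonoid_closure_basis O b,
    fun m hm => ?_, ⟨n, b, rfl⟩, fun M hM₀M z hz => ?_⟩
  · exact (mem_valuationMonoid_iff O).mpr (Units.val_le_val.mpr (hle1 m hm))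
  -- `k[z', y] ⊆ k[M_B]`
  have hRM : R ≤ toricChart (k := k) O x y M := by
    refine Algebra.adjoin_le ?_
    rintro _ ⟨(i | i), rfl⟩
    · show z' i ∈ toricChart (k := k) O x y M
      rw [hz'def i]
      refine lmonomial_mem_toricChart x y (ex i) ⟨γ i, hM₀M (hγsub ?_), ?_⟩
      · exact Finset.mem_coe.mpr (Finset.mem_image_of_mem γ (Finset.mem_univ i))
      · show O.valuation (z' i) = O.valuation ((ex i).prod fun j (n : ℤ) => x j ^ n)
        rw [hz'def i]
    · exact coe_mem_toricChart x y M i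
  have h1 : Qd * (z * yz z) ∈ nrAlg (toricChart (k := k) O x y M) :=
    nrAlg_mono hRM ((mem_nrAlg_iff).mpr (hintR z hz).2)
  have h2 : Qd * yz z ∈ nrAlg (toricChart (k := k) O x y M) :=
    nrAlg_mono hRM ((mem_nrAlg_iff).mpr (hintR z hz).1)
  have hval : O.valuation (Qd * yz z) = 1 := by rw [map_mul, hQd1, hyz1 z hz, one_mul]
  have hyz0 : yz z ≠ 0 := fun h => by
    have := hyz1 z hz
    rw [h, map_zero] at this
    exact zero_ne_one this
  have hz_eq : z = (Qd * (z * yz z)) / (Qd * yz z) := by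
    field_simp
  rw [hz_eq]
  exact div_mem_centreLocalRing h1 h2 hval

end Exhaustion



end Literature.AlgebraicGeometry.Resolution

end
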